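import Mathlib
import HarnessLib

/-!
# Non-square descent — A FINITE MODULE OVER A LOCAL RING IS KILLED BY A POWER OF ANY NON-UNIT (the hypothesis `htors` of the S2 assembly
# of the line card `nonsquare-descent`) for the seed crux `SignedMuSeedAtTwoPlus` stmt-BirchSwinnertonDyer-21438
# (parent Kμ⁺ `SignedMuVanishingAtTwoPlus` stmt-BirchSwinnertonDyer-20689, route ResidualThetaTransportAtTwo)

Cell `bsd-wall`, width seat `bsd-wall-rtt-p4-w2` g17 (`--supports`, closes nothing).  THEOREMS ONLY; BSD is not proved by this; nothing
arithmetic is asserted.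

The S2 assembly `limit_torsionBy_eq_bot` (`Theorems/…NonsquareDescentAssembly.lean`) takes the finiteness of the layers
`B'_k = 𝓔_k^χ/𝒪[G_k]u_k` in the form `htors : ∀ k, ∃ e, ∀ y : B'_k, c^e • y = 0` (`c = 2 ∈ Λ' = 𝒪⟦T⟧`).  This file derives that form
from FINITENESS alone: over a commutative ring `R`, for `c` in the Jacobson radical (e.g. any element of the maximal ideal of a LOCAL ring,
such as `2 ∈ Λ'`) and a finite `R`-module `B`, some power of `c` kills `B` (descending chain `B ⊇ cB ⊇ c²B ⊇ ⋯` stabilises by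
finiteness; Nakayama at the stable step).

* `pow_smul_top_le_of_le` — `c^{e'} B ≤ c^e B` for `e ≤ e'`; `exists_pow_smul_top_eq_succ` — the chain stabilises (pigeonhole);
* **`exists_pow_smul_eq_zero_of_mem_jacobson`** — `c ∈ Jac(R)`, `B` finite ⇒ `∃ e, ∀ y, c^e • y = 0`;
* **`exists_pow_smul_eq_zero_of_mem_maximalIdeal`** — the local-ring form (`c ∈ 𝔪_R`), the shape consumed by `htors`.

[folklore]
-/

set_option autoImplicit false
-- the Theorems namespace of this sub repeats the summit name by design (D-0017 nested layout)
set_option linter.dupNamespace false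

open scoped Pointwise

namespace Summit.BirchSwinnertonDyer.BirchSwinnertonDyer.Theorems.SignedMuAtTwo.NonsquareDescent

section TorsionExponent

variable {R : Type*} [CommRing R] {B : Type*} [AddCommGroup B] [Module R B]

/-- The chain `c^e • B` is decreasing in `e`. [folklore] -/
theorem pow_smul_top_le_of_le (c : R) {e e' : ℕ} (h : e ≤ e') :
    (c ^ e' • (⊤ : Submodule R B)) ≤ c ^ e • (⊤ : Submodule R B) := by
  intro x hx
  obtain ⟨y, -, rfl⟩ := (Submodule.mem_smul_pointwise_iff_exists _ _ _).mp hx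
  refine (Submodule.mem_smul_pointwise_iff_exists _ _ _).mpr ⟨c ^ (e' - e) • y, Submodule.mem_top, ?_⟩
  rw [smul_smul, ← pow_add, Nat.add_sub_cancel' h]

/-- For a FINITE module the chain `c^e • B` stabilises: `c^e B = c^{e+1} B` for some `e`. [folklore] -/
theorem exists_pow_smul_top_eq_succ [Finite B] (c : R) :
    ∃ e : ℕ, (c ^ e • (⊤ : Submodule R B)) = c ^ (e + 1) • (⊤ : Submodule R B) := by
  haveI : Finite (Submodule R B) :=
    Finite.of_injective (fun N : Submodule R B => (N : Set B)) SetLike.coe_injective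
  obtain ⟨a, b, hab, heq⟩ :=
    Finite.exists_ne_map_eq_of_infinite (fun e : ℕ => c ^ e • (⊤ : Submodule R B))
  -- without loss of generality `a < b`
  rcases lt_or_gt_of_ne hab with hlt | hlt
  · refine ⟨a, le_antisymm ?_ (pow_smul_top_le_of_le c (Nat.le_succ a))⟩
    calc c ^ a • (⊤ : Submodule R B) = c ^ b • ⊤ := heq
      _ ≤ c ^ (a + 1) • ⊤ := pow_smul_top_le_of_le c (by omega)
  · refine ⟨b, le_antisymm ?_ (pow_smul_top_le_of_le c (Nat.le_succ b))⟩
    calc c ^ b • (⊤ : Submodule R B) = c ^ a • ⊤ := heq.symm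
      _ ≤ c ^ (b + 1) • ⊤ := pow_smul_top_le_of_le c (by omega)

/-- **A finite module is killed by a power of any element of the Jacobson radical** (chain stabilises + Nakayama). [folklore] -/
theorem exists_pow_smul_eq_zero_of_mem_jacobson [Finite B] {c : R} (hc : c ∈ (⊥ : Ideal R).jacobson) :
    ∃ e : ℕ, ∀ y : B, c ^ e • y = 0 := by
  obtain ⟨e, he⟩ := exists_pow_smul_top_eq_succ (B := B) c
  set N : Submodule R B := c ^ e • (⊤ : Submodule R B) with hNdef
  have hNfg : N.FG := Submodule.FG.of_finite
  have hle : N ≤ Ideal.span {c} • N := by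
    intro x hx
    have hx' : x ∈ c ^ (e + 1) • (⊤ : Submodule R B) := by rw [← he]; exact hx
    obtain ⟨y, -, rfl⟩ := (Submodule.mem_smul_pointwise_iff_exists _ _ _).mp hx'
    rw [pow_succ', mul_smul]
    refine Submodule.smul_mem_smul (Ideal.mem_span_singleton_self c) ?_
    exact (Submodule.mem_smul_pointwise_iff_exists _ _ _).mpr ⟨y, Submodule.mem_top, rfl⟩
  have hjac : Ideal.span {c} ≤ (⊥ : Ideal R).jacobson := by
    rw [Ideal.span_le, Set.singleton_subset_iff]
    exact hc
  have hN : N = ⊥ := Submodule.eq_bot_of_le_smul_of_le_jacobson_bot _ N hNfg hle hjac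
  refine ⟨e, fun y => ?_⟩
  have hy : c ^ e • y ∈ N := (Submodule.mem_smul_pointwise_iff_exists _ _ _).mpr ⟨y, Submodule.mem_top, rfl⟩
  rw [hN, Submodule.mem_bot] at hy
  exact hy

/-- **Local-ring form** (the shape of `htors` in `limit_torsionBy_eq_bot`, with `R = Λ'` local and `c = 2 ∈ 𝔪`): a finite module over a
local ring is killed by a power of any element of the maximal ideal. [folklore] -/
theorem exists_pow_smul_eq_zero_of_mem_maximalIdeal [IsLocalRing R] [Finite B] {c : R}
    (hc : c ∈ IsLocalRing.maximalIdeal R) : ∃ e : ℕ, ∀ y : B, c ^ e • y = 0 :=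
  exists_pow_smul_eq_zero_of_mem_jacobson (IsLocalRing.maximalIdeal_le_jacobson ⊥ hc)

end TorsionExponent

end Summit.BirchSwinnertonDyer.BirchSwinnertonDyer.Theorems.SignedMuAtTwo.NonsquareDescent
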